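import Mathlib
import Summits.Ventures.HodgeRepro.Tier4.Common.AdelicDefs
import Summits.Ventures.HodgeRepro.Tier4.Common.MixedPlaneCusp
import Summits.Ventures.HodgeRepro.Tier4.Line1.TorusBlockScalar
import Summits.Ventures.HodgeRepro.Tier4.Line1.TorusElement
import Summits.Ventures.HodgeRepro.Tier4.Line1.TorusPlaneData
import Summits.Ventures.HodgeRepro.Tier4.Line1.TorusCocompact
import Summits.Ventures.HodgeRepro.Tier4.Line1.NormOneTorus
import Summits.Ventures.HodgeRepro.Tier4.Line1.ThreeLines
import Summits.Ventures.HodgeRepro.Tier4.Line4.LineScalars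
import Summits.Ventures.HodgeRepro.Tier4.Line4.OrbitalUnfoldCentralCosets
import Summits.Ventures.HodgeRepro.Tier4.Line4.CentreCocompact
import Summits.Ventures.HodgeRepro.Tier4.Line4.ReflectionAdapted

/-!
# Tier4/Line4/CentreCocompactAniso — `Z(k)\Z(𝔸)` is compact on every ANISOTROPIC genuine plane: typer-2's displayed
print `hZ` of `CentreCocompact` as a THEOREM, and the `hZc` clause of the (7b) chain by name

Blind re-derivation cell `pub-hodge-repro`, Tier 4 «prove the step» (README §9–§10), seat t4-L4-p2 (prover, LINE L4,
gen 6; cut C-L4-CENTRE-ANISO, self-taken on the empty plate, bus S16394).  Tree path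
`lean/Summits/Ventures/HodgeRepro/Tier4/Line4/CentreCocompactAniso.lean`.  Module 2 of 2 (module 1 = `Line4/ReflectionAdapted`,
the reflection and its algebra).  Mathlib + the tree only; NO printed input; no definition; no instance.

WHAT IS PROVED.  `centre_cocompact_of_anisotropic (hg : IsGenuineRow W) (hA : IsAnisotropic W) : ∃ L : Set (torusT W),
IsCompact L ∧ Z(𝔸) ⊆ Z(k) · L` — exactly the hypothesis `hZ` of typer-2's `exists_compact_centreFin_mul_of_cocompact`
(CentreCocompact p697526: «the PRINT behind it is the cocompactness of the rational points of the anisotropic torus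
`Z = U(1)_{E′/k}` in `Z(𝔸)` (Ono; Godement)»); and `exists_compact_centreFin_mul_of_anisotropic` = the `hZc` binder of
L2-p2's TailSeesawDomain (p719316) by name.  METHOD.  A central `z ∈ T(𝔸)` is `tmat ρ` for a norm-one pair `ρ` of
`E′`-scalars on the two lines `v`, `w` (L1-p5's `exists_pair_of_mem`, TorusCocompact).  The RATIONAL unitary reflection
in `u = v + w` — anisotropic by `hA` (`B(u,u) = B(v,v) + B(w,w)`, `pair_add_self`) — lies in `U(W)(𝔸_k)` (`reflElt`:
`reflAdapted` in the adapted basis `(v, Om v, w, Om w)`, `Om`-linear, `B`-isometric, an involution; the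
`isometry_of_blockScalar` template); `z` central commutes with it, and in the adapted basis `bs · R = R · bs` forces the
two scalars of `ρ` to be EQUAL (`eq_of_blockScalar_comm_reflAdapted`: the `(0,2)` and `(1,2)` entries, `2α′/(α+α′)` a unit).
An equal-pair `tmat` is the `E′`-scalar `x·1 + y·Ω` (`tmat_eq_scalar_of_eq`), central by L1-p3's
`mem_center_of_mat_eq_scalar` and in `T′` by L2-p3's `esc_mul_adMat_comm`.  hstab rung (ii) `normOneTorusCocompact d hd`
(L1-p5, a tree theorem) writes `(x, y) = γ · c`, `γ` rational of norm one, `c` in a compact `C₀`; so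
`z = torusElt (γ, γ) · torusElt (c, c)`, the first rational and central (`rationalCentreT`), the second in the compact
image `L` of the diagonal pairs over `C₀` under the continuous `torusElt`.

READING FOR THE LINE.  The (7b) residual of record lists `hZc` as a print input (lit-5 row I-t4-lit-5-67, Ono/Godement);
on the wall's seesaw plane (anisotropic by SeesawAnisotropic under the dictionary, genuine by
`isGenuineRow_seesawPlane`) it is now a theorem by name — the printed counterpart stays the literature's, nothing of it
is consumed.  Nothing here says anything about the status of the Hodge conjecture for CM abelian varieties, which is
NOT proved; HC_CM is NOT proved by anyone in this repository.
-/

set_option autoImplicit false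

noncomputable section

namespace Summit.Ventures.HodgeRepro.Tier4.Line4

open Matrix Summit.Ventures.HodgeRepro.Tier4.Common Summit.Ventures.HodgeRepro.Tier4.Line1
  Summit.Ventures.HodgeRepro.Tier4.Line1.Rot
open scoped Pointwise

section Main

variable {k : Type} [Field k] [NumberField k] {W : PlaneData k}

omit [NumberField k] in
/-- `B(v+w, v+w) = B(v,v) + B(w,w)` for `B`-orthogonal `v`, `w` (symmetric `B`). -/
theorem pair_add_self {B : Matrix (Fin 4) (Fin 4) k} (hB : Bᵀ = B) (v w : Fin 4 → k)
    (hwv : w ⬝ᵥ (B *ᵥ v) = 0) :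
    (v + w) ⬝ᵥ (B *ᵥ (v + w)) = v ⬝ᵥ (B *ᵥ v) + w ⬝ᵥ (B *ᵥ w) := by
  have hvw : v ⬝ᵥ (B *ᵥ w) = 0 := by rw [pair_comm hB]; exact hwv
  simp only [Matrix.mulVec_add, add_dotProduct, dotProduct_add, hvw, hwv]
  ring

/-- **THE CENTRE IS COCOMPACT modulo its rational points, on an ANISOTROPIC genuine plane** — typer-2's displayed
print `hZ` of `CentreCocompact` («`Z(k)\Z(𝔸)` compact», Ono / Godement) as a theorem.  A central `z ∈ T(𝔸)` is `tmat ρ`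
for a norm-one pair `ρ` (`exists_pair_of_mem`); it commutes with the rational unitary reflection in `v + w`
(anisotropic by `hA`), which forces the two scalars of `ρ` to be EQUAL (`eq_of_tmat_comm_reflConj`); so `z` is the
`E′`-scalar `x + yΩ` (`tmat_eq_scalar_of_eq`), and hstab rung (ii) `normOneTorusCocompact` writes `(x, y) = γ · c` with
`γ` rational and `c` in a compact set — `z = (γ-scalar) · (c-scalar)`, the first rational and central. -/
theorem centre_cocompact_of_anisotropic (hg : IsGenuineRow W) (hA : IsAnisotropic W) :
    ∃ L : Set (torusT W), IsCompact L ∧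
      (((centre W).subgroupOf (torusT W) : Subgroup (torusT W)) : Set (torusT W)) ⊆
        (rationalCentreT W : Set (torusT W)) * L := by
  classical
  have hP : ProjPair W W.P := projPair_P W hg
  obtain ⟨⟨d, hΩ, hd⟩, hrow, -, -, -, -⟩ := hg
  obtain ⟨v, hv, hv0⟩ := exists_row_ne_zero (hP.rank 0) (hP.idem 0)
  obtain ⟨w, hw, hw1⟩ := exists_row_ne_zero (hP.rank 1) (hP.idem 1)
  set D : TorusData k :=
    {
      B := W.B,
      Om := W.Ωᵀ,
      P := (W.P 0)ᵀ,
      d := d,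
      v := v,
      w := w,
      hB := W.B_symm,
      hherm := by rw [Matrix.transpose_transpose]; exact hrow,
      hOm := by
        rw [← Matrix.transpose_mul, hΩ, Matrix.transpose_neg, Matrix.transpose_smul, Matrix.transpose_one],
      hd := hd,
      hdef := fun u hu h => hA ⟨u, hu, h⟩,
      hv := hv,
      hw := hw,
      hwv := by
        have hv' : (W.P 0)ᵀ *ᵥ v = v := by rw [mulVec_transpose]; exact hv0
        have hw' : (W.P 1)ᵀ *ᵥ w = w := by rw [mulVec_transpose]; exact hw1
        rw [pair_comm W.B_symm]
        exact hP.pair_eq_zero hv' hw',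
      hwOv := by
        have hv' : (W.P 0)ᵀ *ᵥ v = v := by rw [mulVec_transpose]; exact hv0
        have hw' : (W.P 1)ᵀ *ᵥ w = w := by rw [mulVec_transpose]; exact hw1
        rw [pair_comm W.B_symm]
        exact hP.pair_eq_zero (hP.mulVec_Ω 0 hv') hw',
      hPv := by rw [mulVec_transpose]; exact hv0,
      hPOv := by
        have hv' : (W.P 0)ᵀ *ᵥ v = v := by rw [mulVec_transpose]; exact hv0
        exact hP.mulVec_Ω 0 hv',
      hPw := by
        have hw' : (W.P 1)ᵀ *ᵥ w = w := by rw [mulVec_transpose]; exact hw1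
        exact hP.mulVec_eq_zero hw',
      hPOw := by
        have hw' : (W.P 1)ᵀ *ᵥ w = w := by rw [mulVec_transpose]; exact hw1
        exact hP.mulVec_eq_zero (hP.mulVec_Ω 1 hw') } with hDdef
  have hDB : D.B = W.B := rfl
  have hDOm : D.Om = W.Ωᵀ := rfl
  have hDP : D.P = (W.P 0)ᵀ := rfl
  have hDd : D.d = d := rfl
  haveI := Line1.t2Space_adeleRing k
  set ι := algebraMap k (Ad k) with hι
  -- the norms of the lines and of `v + w`
  obtain ⟨-, -, -, -, -, hα, hα', -⟩ := D.setup (RingHom.id k)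
  have hα'ne : dataAlpha' D ≠ 0 := hα'
  have hwv0 : w ⬝ᵥ (W.B *ᵥ v) = 0 := D.hwv
  have hs : dataAlpha D + dataAlpha' D ≠ 0 := by
    have hsum : (v + w) ⬝ᵥ (W.B *ᵥ (v + w)) = dataAlpha D + dataAlpha' D := pair_add_self W.B_symm v w hwv0
    rw [← hsum]
    intro h0
    apply hA
    refine ⟨v + w, ?_, h0⟩
    intro hvw
    have hwneg : w = -v := by rw [eq_neg_iff_add_eq_zero, add_comm]; exact hvw
    apply hα
    have : w ⬝ᵥ (W.B *ᵥ v) = -(v ⬝ᵥ (W.B *ᵥ v)) := by rw [hwneg, neg_dotProduct]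
    rw [hwv0] at this
    exact (neg_eq_zero.mp this.symm)
  -- hstab rung (ii)
  obtain ⟨C₀, hC₀, hcov⟩ := normOneTorusCocompact d hd
  -- the closed set of norm-one pairs, the compact set of diagonal pairs from `C₀`
  set N : Set (Fin 4 → Ad k) := {ρ | TorusData.IsNormOne (ι D.d) ρ} with hNdef
  have hN : IsClosed N := by
    have h1 : IsClosed {ρ : Fin 4 → Ad k | ρ 0 * ρ 0 + ι D.d * (ρ 1 * ρ 1) = 1} :=
      isClosed_eq (by fun_prop) continuous_const
    have h2 : IsClosed {ρ : Fin 4 → Ad k | ρ 2 * ρ 2 + ι D.d * (ρ 3 * ρ 3) = 1} :=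
      isClosed_eq (by fun_prop) continuous_const
    exact h1.inter h2
  set K : Set (Fin 4 → Ad k) := (fun p : Fin 2 → Ad k => ![p 0, p 1, p 0, p 1]) '' C₀ with hKdef
  have hK : IsCompact K := by
    refine hC₀.image ?_
    refine continuous_pi fun i => ?_
    fin_cases i <;> fun_prop
  have hKN : IsCompact ((Subtype.val : N → (Fin 4 → Ad k)) ⁻¹' K) :=
    hN.isClosedEmbedding_subtypeVal.isCompact_preimage hK
  let Φ : N → torusT W := fun ρ =>
    ⟨torusElt D hDB hDOm ρ.1 ρ.2, torusElt_mem D hDB hDOm hDP hP ρ.1 ρ.2⟩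
  have hΦ : Continuous Φ := (continuous_torusElt D hDB hDOm).subtype_mk _
  refine ⟨Φ '' (Subtype.val ⁻¹' K), hKN.image hΦ, ?_⟩
  intro z hz
  have hzc : (z : GA W) ∈ centre W := Subgroup.mem_subgroupOf.1 hz
  obtain ⟨ρ, hρ, hρx⟩ := exists_pair_of_mem D hDB hDOm hDP (z : GA W) z.2.1
  have hx : (z : GA W) = torusElt D hDB hDOm ρ hρ := Subtype.ext (Units.ext hρx)
  -- central ⇒ commutes with the reflection ⇒ equal scalars
  have hcomm : D.tmat ι ρ * (reflConj D)ᵀ = (reflConj D)ᵀ * D.tmat ι ρ := by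
    have hc := (Subgroup.mem_center_iff.1 hzc.2) (reflElt D hDB hDOm hs)
    have := congrArg (GA.mat W) hc
    rw [GA.mat_mul, GA.mat_mul, mat_reflElt, hρx] at this
    exact this.symm
  obtain ⟨h02, h13⟩ := eq_of_tmat_comm_reflConj D hα'ne hs ρ hcomm
  -- rung (ii) on the one scalar
  obtain ⟨γ, hγ, c, hcC, hcN, h⟩ := hcov ![ρ 0, ρ 1] (by simpa [qnorm, hDd] using hρ.1)
  set γ4 : Fin 4 → k := ![γ 0, γ 1, γ 0, γ 1] with hγ4def
  set c4 : Fin 4 → Ad k := ![c 0, c 1, c 0, c 1] with hc4def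
  have hγN : TorusData.IsNormOne D.d γ4 := by
    refine ⟨?_, ?_⟩ <;> simpa [qnorm, γ4, hDd] using hγ
  have hcN4 : TorusData.IsNormOne (ι D.d) c4 := by
    refine ⟨?_, ?_⟩ <;> simpa [qnorm, c4, hDd] using hcN
  have hρeq : ρ = TorusData.pmul (ι D.d) (fun i => ι (γ4 i)) c4 := by
    funext i
    fin_cases i
    · have := congrFun h 0
      simp [qmul, qrat] at this
      simpa [TorusData.pmul, γ4, c4, hDd] using this
    · have := congrFun h 1
      simp [qmul, qrat] at this
      simpa [TorusData.pmul, γ4, c4, hDd] using this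
    · have := congrFun h 0
      simp [qmul, qrat] at this
      simp only [Fin.reduceFinMk, TorusData.pmul, γ4, c4, hDd]
      simp only [Matrix.cons_val_two, Matrix.tail_cons, Matrix.head_cons, Matrix.cons_val_zero, Matrix.cons_val_one]
      rw [← h02]; exact this
    · have := congrFun h 1
      simp [qmul, qrat] at this
      simp only [Fin.reduceFinMk, TorusData.pmul, γ4, c4, hDd]
      simp only [Matrix.cons_val_three, Matrix.tail_cons, Matrix.head_cons, Matrix.cons_val_zero, Matrix.cons_val_one]
      rw [← h13]; exact this
  have hcK : (⟨c4, hcN4⟩ : N) ∈ (Subtype.val : N → (Fin 4 → Ad k)) ⁻¹' K := ⟨c, hcC, rfl⟩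
  -- the rational scalar: rational and central
  set g₀ : GA W := torusElt D hDB hDOm (fun i => ι (γ4 i)) (isNormOne_map ι hγN) with hg₀def
  have hg₀T : g₀ ∈ torusT W := torusElt_mem D hDB hDOm hDP hP _ _
  have hg₀mat : GA.mat W g₀ = ι (γ 0) • (1 : M4 k) + ι (γ 1) • adMat k W.Ω := by
    rw [hg₀def, torusElt_mat]
    have := tmat_eq_scalar_of_eq D hDOm (fun i => ι (γ4 i)) (by simp [γ4]) (by simp [γ4])
    simpa [γ4] using this
  have hg₀esc : GA.mat W g₀ = esc W (ι (γ 0)) (ι (γ 1)) := hg₀mat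
  have hg₀T' : g₀ ∈ torusT' W := by
    refine ⟨?_, ?_⟩
    · show GA.mat W g₀ * adMat k (W.Q 0) = adMat k (W.Q 0) * GA.mat W g₀
      rw [hg₀esc]; exact esc_mul_adMat_comm W _ _ (W.Q_comm 0)
    · show GA.mat W g₀ * adMat k (W.Q 1) = adMat k (W.Q 1) * GA.mat W g₀
      rw [hg₀esc]; exact esc_mul_adMat_comm W _ _ (W.Q_comm 1)
  have hg₀Z : g₀ ∈ centre W := ⟨⟨hg₀T, hg₀T'⟩, mem_center_of_mat_eq_scalar W g₀ hg₀mat⟩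
  have hg₀rat : g₀ ∈ rationalPoints W := torusElt_mem_rationalPoints D hDB hDOm γ4 hγN
  refine ⟨⟨g₀, hg₀T⟩, ⟨?_, ?_⟩, Φ ⟨c4, hcN4⟩, ⟨⟨c4, hcN4⟩, hcK, rfl⟩, ?_⟩
  · exact Subgroup.mem_subgroupOf.2 hg₀rat
  · exact Subgroup.mem_subgroupOf.2 hg₀Z
  · apply Subtype.ext
    rw [Subgroup.coe_mul, hx]
    show torusElt D hDB hDOm (fun i => ι (γ4 i)) (isNormOne_map ι hγN) * torusElt D hDB hDOm c4 hcN4 =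
      torusElt D hDB hDOm ρ hρ
    rw [← torusElt_mul]
    subst hρeq
    rfl

/-- **the `hZc` clause of the (7b) chain BY NAME** (TailSeesawDomain's binder): typer-2's
`exists_compact_centreFin_mul_of_cocompact` fed with the theorem above. -/
theorem exists_compact_centreFin_mul_of_anisotropic (hg : IsGenuineRow W) (hA : IsAnisotropic W) :
    ∃ E : Set (torusFin W), IsCompact E ∧ E ⊆ (ZfIn W : Set (torusFin W)) ∧
      (ZfIn W : Set (torusFin W)) ⊆ (centreFin W : Set (torusFin W)) * E :=
  exists_compact_centreFin_mul_of_cocompact W (centre_cocompact_of_anisotropic hg hA)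

end Main

end Summit.Ventures.HodgeRepro.Tier4.Line4

end
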